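import Literature.NumberTheory.EllipticCurves.PAdicLFunctionNonsplitRiemannSumCertificateProofs
import HarnessLib

/-!
# Riemann-sum certificate for THE `p`-adic `L`-function at a SPLIT multiplicative prime
# (theorems only; no definition, no named fact)

Topic `Literature/NumberTheory/EllipticCurves`; split twin of
`PAdicLFunctionNonsplitRiemannSumCertificateProofs.lean` (this seat; abstract truncation bound
`exists_powerSeries_of_bounded_distribution_riemannSum` for the transform of any bounded
distribution) on the tree's split existence / uniqueness
(`PAdicBSDSplitMultiplicativeProofs.lean`: `exists_isSplitMultPAdicLFunctionOf`,
`existsUnique_isSplitMultPAdicLFunctionOf_holds` — bsd.S23; the measure is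
`μₙ(a) = [a/pⁿ]⁺_f`, allowable root `α = a_p = 1`, `ε(p) = 0`, Mazur–Tate–Teitelbaum 1986 §I.10).

## What is proved

For `E = W/ℚ` with SPLIT multiplicative reduction at `p`, `f` its newform, ANY bound `C` of the plus
symbols at `p`-power denominators (`‖[a/pⁿ]⁺_f‖_p ≤ C`; exists by `exists_norm_ratPlusSymbol_le`),
and the exact finite Riemann sums `RS k n = ∑_ξ ∑_{s mod pⁿ} [ξγˢ/p^{n+e₀}]⁺_f·(s choose k)` of
the measure (hypothesis `hRS`, the `PAdicMeasureTransform` pattern):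
* `exists_isSplitMultPAdicLFunctionOf_riemannSum` — existence WITH the truncation bound
  `‖[T^k]L − RS k n‖ ≤ (C/‖k!‖_p)·p⁻ⁿ`;
* `IsSplitMultPAdicLFunctionOf.norm_coeff_sub_riemannSum_le_of_split` — the bound for EVERY `L` of
  the package (uniqueness, bsd.S23);
* `IsSplitMultPAdicLFunctionOf.norm_coeff_eq_of_split_of_lt` / `….coeff_ne_zero_of_split_of_lt` —
  `(C/‖k!‖_p)·p⁻ⁿ < ‖RS k n‖ ⟹ ‖[T^k]L‖ = ‖RS k n‖ ∧ [T^k]L ≠ 0`. With the exceptional zero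
  (`[T⁰]L = 0`, MTT §I.15) the interesting instances are `k = 1` (rank 0: `ord_T L_p = 1`,
  the 𝓛-invariant term) and `k = 2` (rank 1: the binder `hL2 : PowerSeries.coeff 2 L ≠ 0` of
  `Summits/…/X11b/BDPRouteRegulatorCertificate.schneiderConjecture_of_coeff_two_ne_zero`, Disegni's
  split display) — the per-pair bits the lane's multiplicative `p`-adic `L`-series engines compute
  (X11-REPORT, PARI `ellpadicL`), now in KERNEL form: what such a row evidences is exactly the pair
  of hypotheses (`hC`, `hlt`) about the curve's own plus symbols.

HONEST FRAMING (cell `b2b-bsdres`, lane CLASS-CLOSURE, seat cc-typer-6 GEN 7): nothing about any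
particular curve is asserted; `C` and the inequality are hypotheses; nothing is booked.

References: [MazurTateTeitelbaum1986Invent] §I.10 Prop., §I.11–I.15; [SteinWuthrich2013] §3, §4.2;
[Disegni2020] Thm. 4 second bullet (§3.2).
-/

noncomputable section

open Filter Topology
open scoped MatrixGroups ModularForm
open CongruenceSubgroup Literature.NumberTheory.EllipticCurves.ModularForms

namespace Literature.NumberTheory.EllipticCurves

variable {p : ℕ} [Fact p.Prime] {W : WeierstrassCurve ℚ} {N : ℕ} [NeZero N]
  {f : CuspForm (Gamma0 N) 2} {RS : ℕ → ℕ → ℚ_[p]}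
  (hRS : ∀ k n : ℕ, RS k n =
      ∑ᶠ ξ : rootsOfUnity (torsionOrder p) ℤ_[p], ∑ s : ZMod (p ^ n),
        (fun (n : ℕ) (a : ZMod (p ^ n)) ↦ (ratPlusSymbol f ((a.val : ℚ) / (p : ℚ) ^ n) : ℚ_[p]))
          (n + cyclotomicExponent p)
            (PadicInt.toZModPow (n + cyclotomicExponent p) ((ξ : ℤ_[p]ˣ) : ℤ_[p]) *
              (cyclotomicGenerator p : ZMod (p ^ (n + cyclotomicExponent p))) ^ s.val) *
          ((s.val.choose k : ℕ) : ℚ_[p]))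

include hRS

/-- **Existence of `L_p(E, T)` at a SPLIT multiplicative prime, WITH the truncation bound**: for
`f` the newform of `E = W/ℚ`, `p` split multiplicative, and any plus-symbol bound `C`, the Mellin
transform `L` of `μₙ(a) = [a/pⁿ]⁺_f` satisfies `IsSplitMultPAdicLFunctionOf f p L` (the tree's
`exists_isSplitMultPAdicLFunctionOf`, same proof) AND `‖[T^k]L − RS k n‖ ≤ (C/‖k!‖_p)·p⁻ⁿ`.
[cite: MazurTateTeitelbaum1986Invent, §I.10 Prop. and §I.14 (14.3), §I.15] [cite: SteinWuthrich2013, §3] -/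
theorem exists_isSplitMultPAdicLFunctionOf_riemannSum
    (hsplit : W.HasSplitMultiplicativeReductionAtPrime p) (hf : IsNewformOf W f) {C : ℝ}
    (hC : ∀ (n : ℕ) (a : ZMod (p ^ n)), ‖(ratPlusSymbol f ((a.val : ℚ) / (p : ℚ) ^ n) : ℚ_[p])‖ ≤ C) :
    ∃ L : PowerSeries ℚ_[p], IsSplitMultPAdicLFunctionOf f p L ∧
      ∀ k n : ℕ, ‖PowerSeries.coeff k L - RS k n‖ ≤
        C / ‖((k.factorial : ℕ) : ℚ_[p])‖ * (p : ℝ) ^ (-n : ℤ) := by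
  have hQ : coeffField f = ⊥ := hf.coeffField_eq_bot
  have hrat : ∀ r : ℚ, (ratPlusSymbol f r : ℝ) = normalizedPlusSymbol f r :=
    ratCast_ratPlusSymbol_holds hf.1 hQ
  have hap : cuspCoeff f p = 1 := (hf.cuspCoeff_eq_one_and_sq_of_split hsplit).1
  have hpN : p ∣ N := hf.dvd_level_of_split hsplit
  have hdist := sum_fiber_ratPlusSymbol_eq hrat hf.1 hpN hap
  obtain ⟨L, hbd, h0, hχ, hRSle⟩ := exists_powerSeries_of_bounded_distribution_riemannSum
    (μ := fun n a ↦ (ratPlusSymbol f ((a.val : ℚ) / (p : ℚ) ^ n) : ℚ_[p])) hRS hdist hC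
  refine ⟨L, ⟨memIwasawaRat_of_forall_norm_coeff_le hbd, ?_, fun m hm χ _ heven hord ↦ ?_⟩, hRSle⟩
  · rw [h0, sum_units_ratPlusSymbol_eq_zero hrat hf.1 hpN hap, inv_one, sub_self,
      zero_pow two_ne_zero, zero_mul]
  · obtain ⟨m, rfl⟩ := Nat.exists_eq_succ_of_ne_zero hm.ne'
    rw [inv_one, one_pow, map_one, one_mul, ← sum_mul_algebraMap_ratPlusSymbol_eq]
    exact hχ m χ heven hord

/-- **Truncation bound for THE split function**: every `L` with `IsSplitMultPAdicLFunctionOf f p L`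
IS the transform of `[·/pⁿ]⁺_f` (uniqueness, `existsUnique_isSplitMultPAdicLFunctionOf_holds`), so
`‖[T^k]L − RS k n‖ ≤ (C/‖k!‖_p)·p⁻ⁿ`. [cite: MazurTateTeitelbaum1986Invent, §I.14 (14.3)]
[cite: SteinWuthrich2013, §3] -/
theorem IsSplitMultPAdicLFunctionOf.norm_coeff_sub_riemannSum_le_of_split
    (hsplit : W.HasSplitMultiplicativeReductionAtPrime p) (hf : IsNewformOf W f) {C : ℝ}
    (hC : ∀ (n : ℕ) (a : ZMod (p ^ n)), ‖(ratPlusSymbol f ((a.val : ℚ) / (p : ℚ) ^ n) : ℚ_[p])‖ ≤ C)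
    {L : PowerSeries ℚ_[p]} (hL : IsSplitMultPAdicLFunctionOf f p L) (k n : ℕ) :
    ‖PowerSeries.coeff k L - RS k n‖ ≤ C / ‖((k.factorial : ℕ) : ℚ_[p])‖ * (p : ℝ) ^ (-n : ℤ) := by
  obtain ⟨L₀, hL₀, hRSle⟩ := exists_isSplitMultPAdicLFunctionOf_riemannSum hRS hsplit hf hC
  rw [(existsUnique_isSplitMultPAdicLFunctionOf_holds hsplit hf).unique hL hL₀]
  exact hRSle k n

/-- **Certificate for THE split function**: `(C/‖k!‖_p)·p⁻ⁿ < ‖RS k n‖ ⟹ ‖[T^k]L‖ = ‖RS k n‖ ∧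
[T^k]L ≠ 0`, for every `L` of the package. [cite: SteinWuthrich2013, §3 and §4.2]
[cite: MazurTateTeitelbaum1986Invent, §I.11–I.15] -/
theorem IsSplitMultPAdicLFunctionOf.norm_coeff_eq_of_split_of_lt
    (hsplit : W.HasSplitMultiplicativeReductionAtPrime p) (hf : IsNewformOf W f) {C : ℝ}
    (hC : ∀ (n : ℕ) (a : ZMod (p ^ n)), ‖(ratPlusSymbol f ((a.val : ℚ) / (p : ℚ) ^ n) : ℚ_[p])‖ ≤ C)
    {L : PowerSeries ℚ_[p]} (hL : IsSplitMultPAdicLFunctionOf f p L) {k n : ℕ}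
    (hlt : C / ‖((k.factorial : ℕ) : ℚ_[p])‖ * (p : ℝ) ^ (-n : ℤ) < ‖RS k n‖) :
    ‖PowerSeries.coeff k L‖ = ‖RS k n‖ ∧ PowerSeries.coeff k L ≠ 0 := by
  have herr : ‖PowerSeries.coeff k L - RS k n‖ < ‖RS k n‖ :=
    (hL.norm_coeff_sub_riemannSum_le_of_split hRS hsplit hf hC k n).trans_lt hlt
  have heq : ‖PowerSeries.coeff k L‖ = ‖RS k n‖ := by
    have h := IsUltrametricDist.norm_add_eq_max_of_norm_ne_norm herr.ne
    rw [sub_add_cancel, max_eq_right herr.le] at h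
    exact h
  refine ⟨heq, fun h0 ↦ ?_⟩
  have hC0 : 0 ≤ C := (norm_nonneg _).trans (hC 0 0)
  have hpos : 0 < ‖RS k n‖ :=
    lt_of_le_of_lt (mul_nonneg (div_nonneg hC0 (norm_nonneg _)) (zpow_nonneg (by positivity) _))
      hlt
  rw [h0, norm_zero] at heq
  exact hpos.ne heq

/-- **`[T^k]L ≠ 0` from one certified Riemann sum** (split multiplicative `p`, every `L` of the
package): `k = 2` is the binder `hL2` of the split Schneider node (Disegni's exceptional-zero
display; rank one), `k = 1` the rank-zero 𝓛-invariant bit. [cite: SteinWuthrich2013, §3 and §4.2]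
[cite: Disegni2020, Thm. 4 second bullet (§3.2)] -/
theorem IsSplitMultPAdicLFunctionOf.coeff_ne_zero_of_split_of_lt
    (hsplit : W.HasSplitMultiplicativeReductionAtPrime p) (hf : IsNewformOf W f) {C : ℝ}
    (hC : ∀ (n : ℕ) (a : ZMod (p ^ n)), ‖(ratPlusSymbol f ((a.val : ℚ) / (p : ℚ) ^ n) : ℚ_[p])‖ ≤ C)
    {L : PowerSeries ℚ_[p]} (hL : IsSplitMultPAdicLFunctionOf f p L) {k n : ℕ}
    (hlt : C / ‖((k.factorial : ℕ) : ℚ_[p])‖ * (p : ℝ) ^ (-n : ℤ) < ‖RS k n‖) :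
    PowerSeries.coeff k L ≠ 0 :=
  (hL.norm_coeff_eq_of_split_of_lt hRS hsplit hf hC hlt).2

end Literature.NumberTheory.EllipticCurves

end
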